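import Mathlib
import HarnessLib
import Summits.AnomalousDissipation.AnomalousDissipation.Theses.NeutralTaylorWaves
import Literature.Analysis.FunctionSpaces.TorusFluidGlueProofs
import Summits.AnomalousDissipation.AnomalousDissipation.Theorems.NonresonantSelection.Negative.BorderedTestVectors
import Summits.AnomalousDissipation.AnomalousDissipation.Theorems.NonresonantSelection.Negative.TranslationMode
import Summits.AnomalousDissipation.AnomalousDissipation.Theorems.NonresonantSelection.Negative.SecondSymmetry

/-! # Disproof of NonresonantSelection — findings: NO KILL (cdisprove cycle 1, 2026-08-17, on top of the
crux-attack seed). The crux is LITERALLY `TaylorWaveQuasiSteady → NonresonantTaylorWaves` (§A): a refutation needs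
the open construction crux AND the negation of the open route target — out of reach; every definition is honest
(no junk witness, no junk reading). What IS kernel-checked, all LANDED under
`Theorems/NonresonantSelection/Negative/` (import above, cite by name):

(B) `BorderedTestVectors` (p150286): border test `(0,0,1)` ⇒ `1 ≤ M²∫‖∂₃w‖²`; the 2½-D / x₃-invariant
    strengthening of the consequent is FALSE; `‖∂₃w‖₂ ≥ ν^{K₀}/C₀` on every witness.
(C) `BorderedTestVectors`: Galilean triple `(e₃,0,1)` ⇒ the bound WITHOUT the mean-zero test class is false at every
    smooth base (`bordered_false_without_meanZero`): mean-zero `v` is load-bearing.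
(D) NEW `TranslationMode` (p158791) + `SecondSymmetry` (p159142): the translation identity
    `L_{w,c}(∂ᵢw,∂ᵢq) = ∂ᵢ[(w·∇)w − νΔw + ∇q − c∂₃w]` for every direction `i`; hence
    (D1) the PHASE BORDER is load-bearing: the consequent with `⟨v,∂₃w⟩²` deleted forces
         `1 ≤ M⁴‖∂₃(steady map)‖₂²` (`unbordered_one_le`), = `M⁴‖∂₃R‖₂²` for an x₃-invariant force
         (`unbordered_one_le_residual`), and is FALSE at every exact steady state of an x₃-invariant force
         (`unbordered_false_of_steadyState`) — "nonresonant" without "modulo the x₃-phase" kills the intended family;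
    (D2) the border absorbs EXACTLY ONE translation symmetry: at an exact steady state of a force with
         `∂₃f = ∂ᵢf = 0` the BORDERED bound (any `M`) forces `∂ᵢw ≡ t∂₃w` (`bordered_secondSymmetry_rigidity`) —
         the route's single force must break every translation symmetry but x₃ (no Kolmogorov-type forces);
    (D3) below: the same at QUASI-steady states, quantitatively (`bordered_secondSymmetry_quasi`:
         `‖∂ᵢw − t∂₃w‖₂ ≤ M‖∂ᵢR − t∂₃R‖₂`), and the crux-level corollary `unbordered_consequent_residual_floor`;
    (D4) NEW `HorizontalModes` (p159826; re-proved below as `horizontalMode_le`, the tree import is added once the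
         farm has built the module): at ANY smooth div-free base carrying the bordered clause,
         `∃t, ‖∂ᵢw − t∂₃w‖₂ ≤ M‖∂ᵢS − t∂₃S‖₂` (`bordered_translationMode_le`, no steadiness/symmetry assumed):
         for an x₃-invariant force and an `Ḣ¹`-accurate state, `M ≥ ‖∂ᵢw − t∂₃w‖₂/(‖∂ᵢf‖₂ + o(1))`; on the
         intended monophase family the numerator is `≍ ν^{-1/2}` (oblique wavevector of variable direction), so
         the strengthening `K₀ = 0` is impossible THERE — but NOT refutable in general: a witness whose
         Taylor-scale gradient is parallel to `∂₃w` up to `O(1)` in `L²` keeps `O(1)` slack for `(w·∇)w`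
         (= `Σ_{i<3} wᵢ(∂ᵢw − tᵢ∂₃w) + (τ·w)∂₃w`), enough to stay loud; recorded as a dead end.
(T) `-- Targets` (line `birth`, skeleton of 12:18Z): open stubs `stub_spineCore` (= crux core as Keller data),
    `stub_kellerAnalysis` (TRUE: Minkowski + landed linearity `linearisation_add_smul` + Cauchy–Schwarz),
    `stub_kellerAlgebra` (TRUE on paper, `≤ 50Λ⁶`; numerically robust, sup ratio 0.23); landed 2a–2c consistent
    (2c stress-tested: sup ratio 0.39). NO stub broken.
WHY IT RESISTS: the consequent is existential over families; every cheap test vector is either absorbed by the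
border (translation mode), excluded by the test class (Galilean boost), or needs structure the statement does not
assert (second symmetry, C¹-small residual). The genuine content is the adjoint-kernel pairing `⟨∂₃w, ψ*⟩ ≠ 0` with
polynomial control along a subsequence vs. DSZ-type `O(ν^∞)` quasimodes of the two-scale operator on non-isotach
streamlines (BarrierNoteDSZBracket.md) — a statement about the INTENDED family, not about the crux.
lit: search-degraded this cycle (searchd reset, OpenAlex 429); refs as in the crux-attack note (Wei–Zhang–Zhao 2020
doi:10.1016/j.aim.2019.106963; DSZ 2004 doi:10.1002/cpa.20004; Trefethen et al. 1993; Meshalkin–Sinai 1961).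

* §A  logical shape: `nonresonantSelection_iff` (`Iff.rfl`), `nonresonantSelection_of_target`,
  `nonresonantSelection_of_not_construction`, `nonresonantSelection_iff_or`,
  `nonresonantSelection_iff_target_of_construction`, `taylorWaveQuasiSteadyIO_of_target`.
* §B  `Bordered` (the consequent's last clause verbatim), `one_le_of_bordered`, `not_bordered_of_planar`,
  `not_nonresonantTaylorWavesPlanar`, `target_witness_dep3`.
* §C  `BorderedNoMean`, `borderedNoMean_false`, `not_nonresonantTaylorWavesNoMean`,
  `nonresonantSelectionNoMean_iff`.
* §D  `Unbordered`, `unbordered_imp_bordered`, `NonresonantTaylorWavesUnbordered`,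
  `unbordered_consequent_residual_floor`, `not_unbordered_of_exact`, `bordered_secondSymmetry_quasi`,
  `secondSymmetry_exact_rigid`, `horizontalMode_le`, `target_witness_horizontalModes` (re-exports / corollary).
* Targets (line birth): docblock verdicts per stub; `stub_transferAlgebra` numerics.
-/

set_option linter.dupNamespace false

noncomputable section

namespace Summit.AnomalousDissipation.AnomalousDissipation.Cruxes.NonresonantSelection.Disproof

open MeasureTheory Set Filter Topology Function
open Literature.Analysis.FunctionSpaces
open Summit.AnomalousDissipation.AnomalousDissipation.Theses.NeutralTaylorWaves

local notation "𝕋³" => UnitAddTorus (Fin 3)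
local notation "E³" => EuclideanSpace ℝ (Fin 3)

/-! ## §A Logical shape -/

/-- The antecedent of the crux is character-for-character the sibling crux `TaylorWaveQuasiSteady`. -/
theorem nonresonantSelection_iff :
    NonresonantSelection ↔ (TaylorWaveQuasiSteady → NonresonantTaylorWaves) := Iff.rfl

/-- The target implies the crux (the crux is weaker than the target). -/
theorem nonresonantSelection_of_target : NonresonantTaylorWaves → NonresonantSelection := fun h _ => h

/-- A refutation of the construction crux would prove this crux vacuously. -/
theorem nonresonantSelection_of_not_construction (h : ¬ TaylorWaveQuasiSteady) :
    NonresonantSelection := fun hH => absurd hH h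

/-- Pure logic: the crux is `¬H ∨ T`; the consequent RE-QUANTIFIES `f, ν, E, ε₀` (no link to the
antecedent's family is asserted). -/
theorem nonresonantSelection_iff_or :
    NonresonantSelection ↔ (¬ TaylorWaveQuasiSteady ∨ NonresonantTaylorWaves) :=
  ⟨fun h => (Classical.em TaylorWaveQuasiSteady).elim (fun hH => Or.inr (h hH)) Or.inl,
   fun h hH => h.elim (fun n => absurd hH n) id⟩

/-- **Costume probe.** As soon as the sibling construction crux holds, this crux IS the route
target (rank 0): the split `X = TaylorWaveQuasiSteady ∧ (TaylorWaveQuasiSteady → X)` does not factor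
the work, because the antecedent is an opaque existential that exports no structure (no profile, no
band, no sup bounds) — a proof of the crux must rebuild a structured family and prove the bordered
bound for it, i.e. prove `X`. -/
theorem nonresonantSelection_iff_target_of_construction (hH : TaylorWaveQuasiSteady) :
    NonresonantSelection ↔ NonresonantTaylorWaves :=
  ⟨fun h => h hH, fun hT _ => hT⟩

/-- The construction crux with "for every `n`" weakened to "for infinitely many `n`" (per order). -/
def TaylorWaveQuasiSteadyIO : Prop :=
  ∃ f : 𝕋³ → E³, Torus.IsSmooth f ∧ Torus.IsDivFree f ∧ Torus.HasZeroMean f ∧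
  ∃ (ν : ℕ → ℝ) (E ε₀ : ℝ), (∀ n, 0 < ν n) ∧ Filter.Tendsto ν Filter.atTop (nhds 0) ∧ 0 < ε₀ ∧
  ∀ K : ℕ, ∃ C : ℝ, ∀ N : ℕ, ∃ n : ℕ, N ≤ n ∧ ∃ (w : 𝕋³ → E³) (q : 𝕋³ → ℝ) (c : ℝ),
  Torus.IsSmooth w ∧ Torus.IsSmooth q ∧ Torus.IsDivFree w ∧ Torus.HasZeroMean w ∧ |c| ≤ C ∧
  MeasureTheory.integral MeasureTheory.volume (fun x => ‖w x‖ ^ 2) ≤ E ∧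
  |ν n * Torus.gradNormSq w - ε₀| ≤ C * Real.sqrt (ν n) ∧
  MeasureTheory.integral MeasureTheory.volume (fun x => ‖Torus.convect w w x - (ν n) • Torus.laplacian w x +
    Torus.gradient q x - c • Torus.partialDeriv (2 : Fin 3) w x - f x‖ ^ 2) ≤ C * (ν n) ^ K

/-- **The target already contains the construction crux up to `∀ n` ↦ `infinitely many n`**: drop the
sup bounds and the bordered clause. Together with `nonresonantSelection_of_target` this shows the
route's two cruxes #2, #3 are, modulo that bookkeeping, the target split as `H` and `H → X` with
`X ⇒ H`. -/
theorem taylorWaveQuasiSteadyIO_of_target (hT : NonresonantTaylorWaves) : TaylorWaveQuasiSteadyIO := by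
  obtain ⟨f, hf, hfd, hfm, ν, E, ε₀, C₀, K₀, hν, hlim, hε, hK⟩ := hT
  refine ⟨f, hf, hfd, hfm, ν, E, ε₀, hν, hlim, hε, fun K => ?_⟩
  obtain ⟨C, hC⟩ := hK K
  refine ⟨C, fun N => ?_⟩
  obtain ⟨n, hn, w, q, c, hw, hq, hwd, hwm, hc, hE, hdiss, hres, -, -, -, -⟩ := hC N
  exact ⟨n, hn, w, q, c, hw, hq, hwd, hwm, hc, hE, hdiss, hres⟩

/-! ## §B The border direction is load-bearing: witnesses are genuinely 3-D -/

/-- The bordered a-priori clause of `NonresonantTaylorWaves`, verbatim, as a predicate. -/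
def Bordered (ν : ℝ) (w : 𝕋³ → E³) (c M : ℝ) : Prop :=
  ∀ (v : 𝕋³ → E³) (r : 𝕋³ → ℝ) (b : ℝ), Torus.IsSmooth v → Torus.IsSmooth r →
    Torus.IsDivFree v → Torus.HasZeroMean v →
    MeasureTheory.integral MeasureTheory.volume (fun x => ‖v x‖ ^ 2) + b ^ 2 ≤
      (M) ^ 2 * (MeasureTheory.integral MeasureTheory.volume (fun x =>
        ‖Torus.convect w v x + Torus.convect v w x - ν • Torus.laplacian v x +
          Torus.gradient r x - c • Torus.partialDeriv (2 : Fin 3) v x -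
          b • Torus.partialDeriv (2 : Fin 3) w x‖ ^ 2) +
        (MeasureTheory.integral MeasureTheory.volume (fun x =>
          inner ℝ (v x) (Torus.partialDeriv (2 : Fin 3) w x))) ^ 2)

theorem isSmooth_zero_field : Torus.IsSmooth (fun _ : 𝕋³ => (0 : E³)) := Torus.isSmooth_const _
theorem isSmooth_zero_scalar : Torus.IsSmooth (fun _ : 𝕋³ => (0 : ℝ)) := Torus.isSmooth_const _

theorem partialDeriv_zero_field (i : Fin 3) (x : 𝕋³) :
    Torus.partialDeriv i (fun _ : 𝕋³ => (0 : E³)) x = 0 := by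
  simp [Torus.partialDeriv, Torus.lineDeriv]

theorem partialDeriv_zero_scalar (i : Fin 3) (x : 𝕋³) :
    Torus.partialDeriv i (fun _ : 𝕋³ => (0 : ℝ)) x = 0 := by
  simp [Torus.partialDeriv, Torus.lineDeriv]

theorem isDivFree_zero_field : Torus.IsDivFree (fun _ : 𝕋³ => (0 : E³)) := by
  intro x
  simp only [Torus.divergence, PiLp.zero_apply]
  exact Finset.sum_eq_zero fun i _ => partialDeriv_zero_scalar i x

theorem hasZeroMean_zero_field : Torus.HasZeroMean (fun _ : 𝕋³ => (0 : E³)) := by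
  simp [Torus.HasZeroMean]

theorem convect_zero_right (w : 𝕋³ → E³) (x : 𝕋³) :
    Torus.convect w (fun _ : 𝕋³ => (0 : E³)) x = 0 := by
  unfold Torus.convect Torus.fderiv Torus.liftAt
  simp

theorem convect_zero_left (w : 𝕋³ → E³) (x : 𝕋³) :
    Torus.convect (fun _ : 𝕋³ => (0 : E³)) w x = 0 := by
  unfold Torus.convect
  simp

theorem laplacian_zero_field (x : 𝕋³) :
    Torus.laplacian (fun _ : 𝕋³ => (0 : E³)) x = 0 := by
  unfold Torus.laplacian Torus.liftAt
  simp

theorem gradient_zero_scalar (x : 𝕋³) :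
    Torus.gradient (fun _ : 𝕋³ => (0 : ℝ)) x = 0 := by
  unfold Torus.gradient Torus.liftAt
  simp [_root_.gradient]

/-- **Border test `(v, r, b) = (0, 0, 1)`.** Any base `(w, c)` carrying the bordered a-priori bound
with constant `M` has `1 ≤ M² ∫ ‖∂₃ w‖²`: the drift unknown `b` is controlled only through `b ∂₃ w`. -/
theorem one_le_of_bordered {ν : ℝ} {w : 𝕋³ → E³} {c M : ℝ} (h : Bordered ν w c M) :
    1 ≤ M ^ 2 * MeasureTheory.integral MeasureTheory.volume
      (fun x => ‖Torus.partialDeriv (2 : Fin 3) w x‖ ^ 2) := by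
  have key := h (fun _ => 0) (fun _ => 0) 1 isSmooth_zero_field isSmooth_zero_scalar
    isDivFree_zero_field hasZeroMean_zero_field
  simp only [convect_zero_right, convect_zero_left, laplacian_zero_field, gradient_zero_scalar,
    partialDeriv_zero_field, smul_zero, sub_zero, add_zero, zero_add, one_smul, norm_zero,
    inner_zero_left, integral_zero, zero_sub, norm_neg, one_pow,
    ne_eq, OfNat.ofNat_ne_zero, not_false_eq_true, zero_pow] at key
  simpa using key

/-- Hence an `x₃`-invariant base (`∂₃ w ≡ 0`) NEVER carries the bordered bound, whatever `M`. -/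
theorem not_bordered_of_planar {ν : ℝ} {w : 𝕋³ → E³} {c M : ℝ}
    (hw : ∀ x, Torus.partialDeriv (2 : Fin 3) w x = 0) : ¬ Bordered ν w c M := by
  intro h
  have h1 := one_le_of_bordered h
  simp only [hw, norm_zero, ne_eq, OfNat.ofNat_ne_zero, not_false_eq_true, zero_pow,
    integral_zero, mul_zero] at h1
  exact absurd h1 (by norm_num)

/-- The natural degenerate strengthening of the route target: the same sixteen clauses PLUS
"`w` is `x₃`-invariant" (2½-D witnesses, axial number `m = 0`). -/
def NonresonantTaylorWavesPlanar : Prop :=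
  ∃ f : 𝕋³ → E³, Torus.IsSmooth f ∧ Torus.IsDivFree f ∧ Torus.HasZeroMean f ∧
  ∃ (ν : ℕ → ℝ) (E ε₀ C₀ : ℝ) (K₀ : ℕ), (∀ n, 0 < ν n) ∧ Filter.Tendsto ν Filter.atTop (nhds 0) ∧
  0 < ε₀ ∧ ∀ K : ℕ, ∃ C : ℝ, ∀ N : ℕ, ∃ n : ℕ, N ≤ n ∧ ∃ (w : 𝕋³ → E³) (q : 𝕋³ → ℝ) (c : ℝ),
  Torus.IsSmooth w ∧ Torus.IsSmooth q ∧ Torus.IsDivFree w ∧ Torus.HasZeroMean w ∧ |c| ≤ C ∧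
  MeasureTheory.integral MeasureTheory.volume (fun x => ‖w x‖ ^ 2) ≤ E ∧
  |ν n * Torus.gradNormSq w - ε₀| ≤ C * Real.sqrt (ν n) ∧
  MeasureTheory.integral MeasureTheory.volume (fun x => ‖Torus.convect w w x - (ν n) • Torus.laplacian w x +
    Torus.gradient q x - c • Torus.partialDeriv (2 : Fin 3) w x - f x‖ ^ 2) ≤ C * (ν n) ^ K ∧
  (∀ x, ‖w x‖ ≤ C) ∧ (∀ (i : Fin 3) x, ‖Torus.partialDeriv i w x‖ ≤ C * (ν n)⁻¹) ∧
  (∀ (i j : Fin 3) x, ‖Torus.partialDeriv i (Torus.partialDeriv j w) x‖ ≤ C * (ν n)⁻¹ ^ 2) ∧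
  (∀ x, Torus.partialDeriv (2 : Fin 3) w x = 0) ∧
  Bordered (ν n) w c (C₀ * (ν n)⁻¹ ^ K₀)

/-- **The 2½-D strengthening of the target is false**: with `∂₃ w ≡ 0` the border column `b ∂₃ w`
vanishes and `(v, r, b) = (0, 0, 1)` is an exact kernel vector of the bordered operator. So the
consequent of the crux can only be witnessed by genuinely three-dimensional states (axial number
`m ≠ 0`), consistent with the route's evasion of the Alexakis–Doering 2-D bound. -/
theorem not_nonresonantTaylorWavesPlanar : ¬ NonresonantTaylorWavesPlanar := by
  rintro ⟨f, -, -, -, ν, E, ε₀, C₀, K₀, -, -, -, hK⟩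
  obtain ⟨C, hC⟩ := hK 0
  obtain ⟨n, -, w, q, c, -, -, -, -, -, -, -, -, -, -, -, hplanar, hB⟩ := hC 0
  exact not_bordered_of_planar hplanar hB

/-- Sanity link: the last clause of the route target is `Bordered (ν n) w c (C₀ * (ν n)⁻¹ ^ K₀)`
verbatim, so `one_le_of_bordered` applies to every witness of `NonresonantTaylorWaves`:
along the selected subsequence `‖∂₃ w‖₂² ≥ (C₀ ν_n^{-K₀})⁻²`. -/
theorem target_witness_dep3 (hT : NonresonantTaylorWaves) :
    ∃ (ν : ℕ → ℝ) (C₀ : ℝ) (K₀ : ℕ), ∀ K : ℕ, ∀ N : ℕ, ∃ n : ℕ, N ≤ n ∧ ∃ w : 𝕋³ → E³,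
      Torus.IsSmooth w ∧ 1 ≤ (C₀ * (ν n)⁻¹ ^ K₀) ^ 2 * MeasureTheory.integral MeasureTheory.volume
        (fun x => ‖Torus.partialDeriv (2 : Fin 3) w x‖ ^ 2) := by
  obtain ⟨f, -, -, -, ν, E, ε₀, C₀, K₀, -, -, -, hK⟩ := hT
  refine ⟨ν, C₀, K₀, fun K N => ?_⟩
  obtain ⟨C, hC⟩ := hK K
  obtain ⟨n, hn, w, q, c, hw, -, -, -, -, -, -, -, -, -, -, hB⟩ := hC N
  exact ⟨n, hn, w, hw, one_le_of_bordered hB⟩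

/-! ## §C Load-bearing hypothesis: the mean-zero restriction on test fields (Galilean boost)

Dropping `HasZeroMean v` from the bordered clause makes it FALSE at every smooth base `(w, c)`,
every viscosity and every constant `M`: the Galilean triple `(v, r, b) = (e₃, 0, 1)` is an exact
kernel vector of the bordered operator (`e₃·∇w − 1·∂₃w = 0`, `∫⟪e₃, ∂₃w⟫ = 0` by periodicity).
So any proof of the crux must use the mean-zero test class; the drift/boost degeneracy that killed
`CorrelationEnergyUnboundedNeg` (negatives index) is exactly what this normalisation removes. -/

/-- The bordered clause WITHOUT the mean-zero restriction on the test field `v`. -/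
def BorderedNoMean (ν : ℝ) (w : 𝕋³ → E³) (c M : ℝ) : Prop :=
  ∀ (v : 𝕋³ → E³) (r : 𝕋³ → ℝ) (b : ℝ), Torus.IsSmooth v → Torus.IsSmooth r →
    Torus.IsDivFree v →
    MeasureTheory.integral MeasureTheory.volume (fun x => ‖v x‖ ^ 2) + b ^ 2 ≤
      (M) ^ 2 * (MeasureTheory.integral MeasureTheory.volume (fun x =>
        ‖Torus.convect w v x + Torus.convect v w x - ν • Torus.laplacian v x +
          Torus.gradient r x - c • Torus.partialDeriv (2 : Fin 3) v x -
          b • Torus.partialDeriv (2 : Fin 3) w x‖ ^ 2) +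
        (MeasureTheory.integral MeasureTheory.volume (fun x =>
          inner ℝ (v x) (Torus.partialDeriv (2 : Fin 3) w x))) ^ 2)

theorem partialDeriv_const_field (e : E³) (i : Fin 3) (x : 𝕋³) :
    Torus.partialDeriv i (fun _ : 𝕋³ => e) x = 0 := by
  simp [Torus.partialDeriv, Torus.lineDeriv]

theorem isDivFree_const_field (e : E³) : Torus.IsDivFree (fun _ : 𝕋³ => e) := by
  intro x
  simp only [Torus.divergence]
  exact Finset.sum_eq_zero fun i _ => by simp [Torus.partialDeriv, Torus.lineDeriv]

theorem convect_const_right (w : 𝕋³ → E³) (e : E³) (x : 𝕋³) :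
    Torus.convect w (fun _ : 𝕋³ => e) x = 0 := by
  unfold Torus.convect Torus.fderiv Torus.liftAt
  simp

/-- For a `C¹` base, convecting `w` along the constant field `eᵢ` is `∂ᵢ w`. -/
theorem convect_const_left {w : 𝕋³ → E³} (hw : Torus.IsSmooth w) (i : Fin 3) (x : 𝕋³) :
    Torus.convect (fun _ : 𝕋³ => EuclideanSpace.single i (1 : ℝ)) w x = Torus.partialDeriv i w x := by
  unfold Torus.convect
  exact (Torus.partialDeriv_eq_fderiv_apply (hw.isContDiff (by simp)) i x).symm

theorem laplacian_const_field (e : E³) (x : 𝕋³) : Torus.laplacian (fun _ : 𝕋³ => e) x = 0 := by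
  rw [Torus.laplacian_eq_sum_partialDeriv_partialDeriv (Torus.isSmooth_const e)]
  refine Finset.sum_eq_zero fun i _ => ?_
  have h : Torus.partialDeriv i (fun _ : 𝕋³ => e) = fun _ => (0 : E³) :=
    funext (partialDeriv_const_field e i)
  rw [h, partialDeriv_zero_field]

/-- `∫ ⟪e, ∂ᵢ w⟫ = 0` for a constant `e` and smooth periodic `w`. -/
theorem integral_inner_const_partialDeriv {w : 𝕋³ → E³} (hw : Torus.IsSmooth w) (e : E³) (i : Fin 3) :
    MeasureTheory.integral MeasureTheory.volume
      (fun x => inner ℝ ((fun _ : 𝕋³ => e) x) (Torus.partialDeriv i w x)) = 0 := by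
  have h := Torus.integral_inner_partialDeriv_eq_neg (Torus.isSmooth_const e) hw i
  have h0 : (fun x => inner ℝ (Torus.partialDeriv i (fun _ : 𝕋³ => e) x) (w x)) = fun _ => (0 : ℝ) := by
    funext x
    rw [partialDeriv_const_field, inner_zero_left]
  rw [h0] at h
  simp only [integral_zero, zero_eq_neg] at h
  simpa using h

/-- **`_false_without_` the mean-zero test class.** At every smooth base `w`, drift `c`, viscosity
`ν` and constant `M`, the un-normalised bordered bound fails: Galilean witness `(e₃, 0, 1)`. -/
theorem borderedNoMean_false {ν : ℝ} {w : 𝕋³ → E³} (hw : Torus.IsSmooth w) (c M : ℝ) :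
    ¬ BorderedNoMean ν w c M := by
  intro h
  have key := h (fun _ => EuclideanSpace.single (2 : Fin 3) (1 : ℝ)) (fun _ => 0) 1
    (Torus.isSmooth_const _) isSmooth_zero_scalar (isDivFree_const_field _)
  rw [integral_inner_const_partialDeriv hw] at key
  simp only [convect_const_right, convect_const_left hw, laplacian_const_field, gradient_zero_scalar,
    partialDeriv_const_field, smul_zero, sub_zero, add_zero, zero_add, one_smul, sub_self,
    norm_zero, ne_eq, OfNat.ofNat_ne_zero, not_false_eq_true, zero_pow, integral_zero,
    mul_zero, one_pow] at key
  have hpos : 0 ≤ MeasureTheory.integral MeasureTheory.volume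
      (fun x : 𝕋³ => ‖(fun _ : 𝕋³ => EuclideanSpace.single (2 : Fin 3) (1 : ℝ)) x‖ ^ 2) :=
    integral_nonneg fun _ => by positivity
  linarith

/-- The crux's consequent with the mean-zero restriction on test fields dropped. -/
def NonresonantTaylorWavesNoMean : Prop :=
  ∃ f : 𝕋³ → E³, Torus.IsSmooth f ∧ Torus.IsDivFree f ∧ Torus.HasZeroMean f ∧
  ∃ (ν : ℕ → ℝ) (E ε₀ C₀ : ℝ) (K₀ : ℕ), (∀ n, 0 < ν n) ∧ Filter.Tendsto ν Filter.atTop (nhds 0) ∧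
  0 < ε₀ ∧ ∀ K : ℕ, ∃ C : ℝ, ∀ N : ℕ, ∃ n : ℕ, N ≤ n ∧ ∃ (w : 𝕋³ → E³) (q : 𝕋³ → ℝ) (c : ℝ),
  Torus.IsSmooth w ∧ Torus.IsSmooth q ∧ Torus.IsDivFree w ∧ Torus.HasZeroMean w ∧ |c| ≤ C ∧
  MeasureTheory.integral MeasureTheory.volume (fun x => ‖w x‖ ^ 2) ≤ E ∧
  |ν n * Torus.gradNormSq w - ε₀| ≤ C * Real.sqrt (ν n) ∧
  MeasureTheory.integral MeasureTheory.volume (fun x => ‖Torus.convect w w x - (ν n) • Torus.laplacian w x +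
    Torus.gradient q x - c • Torus.partialDeriv (2 : Fin 3) w x - f x‖ ^ 2) ≤ C * (ν n) ^ K ∧
  (∀ x, ‖w x‖ ≤ C) ∧ (∀ (i : Fin 3) x, ‖Torus.partialDeriv i w x‖ ≤ C * (ν n)⁻¹) ∧
  (∀ (i j : Fin 3) x, ‖Torus.partialDeriv i (Torus.partialDeriv j w) x‖ ≤ C * (ν n)⁻¹ ^ 2) ∧
  BorderedNoMean (ν n) w c (C₀ * (ν n)⁻¹ ^ K₀)

/-- The consequent without the mean-zero test class is FALSE outright; hence the crux without it
is equivalent to `¬ TaylorWaveQuasiSteady` (it would then "prove" the negation of its own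
sibling crux). -/
theorem not_nonresonantTaylorWavesNoMean : ¬ NonresonantTaylorWavesNoMean := by
  rintro ⟨f, -, -, -, ν, E, ε₀, C₀, K₀, -, -, -, hK⟩
  obtain ⟨C, hC⟩ := hK 0
  obtain ⟨n, -, w, q, c, hw, -, -, -, -, -, -, -, -, -, -, hB⟩ := hC 0
  exact borderedNoMean_false hw c _ hB

theorem nonresonantSelectionNoMean_iff :
    ((TaylorWaveQuasiSteady → NonresonantTaylorWavesNoMean) ↔ ¬ TaylorWaveQuasiSteady) :=
  ⟨fun h hH => not_nonresonantTaylorWavesNoMean (h hH), fun h hH => absurd hH h⟩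

/-! ## §D Translation modes: the phase border is load-bearing; a second symmetry is inherited

LANDED (cdisprove cycle 1): `Theorems/NonresonantSelection/Negative/TranslationMode.lean` (p158791) and
`Theorems/NonresonantSelection/Negative/SecondSymmetry.lean` (p159142), namespace
`Summit.AnomalousDissipation.AnomalousDissipation.Theorems.NonresonantSelection.Negative`:
`linearisation_partialDeriv_eq` (translation identity `L_{w,c}(∂ᵢw,∂ᵢq) = ∂ᵢ[steady map]`),
`isDivFree_partialDeriv`, `unbordered_one_le`, `unbordered_one_le_residual`, `unbordered_false_of_steadyState`,
`linearisation_add_smul`, `bordered_secondSymmetry_rigidity`. This section phrases them against the crux and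
adds the quasi-steady (quantitative) form of the second-symmetry rigidity. -/

open Summit.AnomalousDissipation.AnomalousDissipation.Theorems.NonresonantSelection

/-- The consequent's a-priori clause with the phase border `(∫⟪v, ∂₃w⟫)²` DELETED ("nonresonant", not
"nonresonant modulo the x₃-phase"). -/
def Unbordered (ν : ℝ) (w : 𝕋³ → E³) (c M : ℝ) : Prop :=
  ∀ (v : 𝕋³ → E³) (r : 𝕋³ → ℝ) (b : ℝ), Torus.IsSmooth v → Torus.IsSmooth r →
    Torus.IsDivFree v → Torus.HasZeroMean v →
    MeasureTheory.integral MeasureTheory.volume (fun x => ‖v x‖ ^ 2) + b ^ 2 ≤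
      (M) ^ 2 * MeasureTheory.integral MeasureTheory.volume (fun x =>
        ‖Torus.convect w v x + Torus.convect v w x - ν • Torus.laplacian v x +
          Torus.gradient r x - c • Torus.partialDeriv (2 : Fin 3) v x -
          b • Torus.partialDeriv (2 : Fin 3) w x‖ ^ 2)

/-- Deleting the (non-negative) border term only strengthens the clause. -/
theorem unbordered_imp_bordered {ν : ℝ} {w : 𝕋³ → E³} {c M : ℝ} (h : Unbordered ν w c M) :
    Bordered ν w c M := fun v r b hv hr hvd hvm =>
  (h v r b hv hr hvd hvm).trans
    (mul_le_mul_of_nonneg_left (le_add_of_nonneg_right (sq_nonneg _)) (sq_nonneg M))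

/-- The steady map `S_{ν,c}(w,q) = (w·∇)w − νΔw + ∇q − c∂₃w` (the crux's residual is `S − f`). -/
def steadyMap (ν : ℝ) (w : 𝕋³ → E³) (q : 𝕋³ → ℝ) (c : ℝ) (y : 𝕋³) : E³ :=
  Torus.convect w w y - ν • Torus.laplacian w y + Torus.gradient q y - c • Torus.partialDeriv (2 : Fin 3) w y

/-- **(D1) Residual floor for the un-bordered strengthening.** If a smooth divergence-free base carries the
UN-bordered clause with constant `M`, then `1 ≤ M⁴ ∫‖∂₃ S_{ν,c}(w,q)‖²` (landed `unbordered_one_le`): with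
`M = C₀ν^{-K₀}` the `x₃`-derivative of `S = f + R` is at least `ν^{2K₀}/C₀²` in `L²`; for an `x₃`-invariant
force that is `‖∂₃R‖₂ ≥ ν^{2K₀}/C₀²` — incompatible with all-orders quasi-steadiness in `C¹`, which the
intended BKW family has. So the border is not removable. -/
theorem unbordered_residual_floor {ν : ℝ} {w : 𝕋³ → E³} {q : 𝕋³ → ℝ} {c M : ℝ}
    (hw : Torus.IsSmooth w) (hq : Torus.IsSmooth q) (hdiv : Torus.IsDivFree w) (h : Unbordered ν w c M) :
    1 ≤ M ^ 4 * MeasureTheory.integral MeasureTheory.volume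
      (fun x => ‖Torus.partialDeriv (2 : Fin 3) (steadyMap ν w q c) x‖ ^ 2) :=
  Negative.unbordered_one_le hw hq hdiv h

/-- The consequent of the crux with the border deleted (all other fifteen clauses verbatim). -/
def NonresonantTaylorWavesUnbordered : Prop :=
  ∃ f : 𝕋³ → E³, Torus.IsSmooth f ∧ Torus.IsDivFree f ∧ Torus.HasZeroMean f ∧
  ∃ (ν : ℕ → ℝ) (E ε₀ C₀ : ℝ) (K₀ : ℕ), (∀ n, 0 < ν n) ∧ Filter.Tendsto ν Filter.atTop (nhds 0) ∧
  0 < ε₀ ∧ ∀ K : ℕ, ∃ C : ℝ, ∀ N : ℕ, ∃ n : ℕ, N ≤ n ∧ ∃ (w : 𝕋³ → E³) (q : 𝕋³ → ℝ) (c : ℝ),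
  Torus.IsSmooth w ∧ Torus.IsSmooth q ∧ Torus.IsDivFree w ∧ Torus.HasZeroMean w ∧ |c| ≤ C ∧
  MeasureTheory.integral MeasureTheory.volume (fun x => ‖w x‖ ^ 2) ≤ E ∧
  |ν n * Torus.gradNormSq w - ε₀| ≤ C * Real.sqrt (ν n) ∧
  MeasureTheory.integral MeasureTheory.volume (fun x => ‖Torus.convect w w x - (ν n) • Torus.laplacian w x +
    Torus.gradient q x - c • Torus.partialDeriv (2 : Fin 3) w x - f x‖ ^ 2) ≤ C * (ν n) ^ K ∧
  (∀ x, ‖w x‖ ≤ C) ∧ (∀ (i : Fin 3) x, ‖Torus.partialDeriv i w x‖ ≤ C * (ν n)⁻¹) ∧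
  (∀ (i j : Fin 3) x, ‖Torus.partialDeriv i (Torus.partialDeriv j w) x‖ ≤ C * (ν n)⁻¹ ^ 2) ∧
  Unbordered (ν n) w c (C₀ * (ν n)⁻¹ ^ K₀)

/-- **(D1, crux level).** Every witness family of the un-bordered consequent obeys the residual floor
`1 ≤ (C₀ν_n^{-K₀})⁴ ∫‖∂₃ S(w_n)‖²` along its subsequence — a necessary condition no all-orders family with an
`x₃`-invariant force can meet (there `∂₃S = ∂₃R_K = O(ν^{K/2})` in every norm for the BKW family). -/
theorem unbordered_consequent_residual_floor (hT : NonresonantTaylorWavesUnbordered) :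
    ∃ (ν : ℕ → ℝ) (C₀ : ℝ) (K₀ : ℕ), ∀ K : ℕ, ∀ N : ℕ, ∃ n : ℕ, N ≤ n ∧ ∃ (w : 𝕋³ → E³) (q : 𝕋³ → ℝ) (c : ℝ),
      1 ≤ (C₀ * (ν n)⁻¹ ^ K₀) ^ 4 * MeasureTheory.integral MeasureTheory.volume
        (fun x => ‖Torus.partialDeriv (2 : Fin 3) (steadyMap (ν n) w q c) x‖ ^ 2) := by
  obtain ⟨f, -, -, -, ν, E, ε₀, C₀, K₀, -, -, -, hK⟩ := hT
  refine ⟨ν, C₀, K₀, fun K N => ?_⟩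
  obtain ⟨C, hC⟩ := hK K
  obtain ⟨n, hn, w, q, c, hw, hq, hwd, -, -, -, -, -, -, -, -, hU⟩ := hC N
  exact ⟨n, hn, w, q, c, unbordered_residual_floor hw hq hwd hU⟩

/-- **(D1, exact states).** The un-bordered clause is FALSE (every `M`) at every exact smooth steady state of an
`x₃`-invariant force — the realised states of the route are of this kind (landed
`unbordered_false_of_steadyState`; kernel triples `(0,0,1)` and `(∂₃w, ∂₃q, 0)`). -/
theorem not_unbordered_of_exact {ν : ℝ} {w f : 𝕋³ → E³} {q : 𝕋³ → ℝ} {c : ℝ}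
    (hw : Torus.IsSmooth w) (hq : Torus.IsSmooth q) (hdiv : Torus.IsDivFree w)
    (hsteady : ∀ x, steadyMap ν w q c x = f x) (hf3 : ∀ x, Torus.partialDeriv (2 : Fin 3) f x = 0) (M : ℝ) :
    ¬ Unbordered ν w c M :=
  Negative.unbordered_false_of_steadyState hw hq hdiv hsteady hf3 M

/-- **(D2, exact states; re-export).** At an exact smooth steady state of a force with `∂₃f = ∂ᵢf = 0`, the
BORDERED clause (any `M`) forces `∂ᵢw ≡ t ∂₃w`: a second continuous symmetry cannot be broken by a
bordered-nonresonant steady state (landed `bordered_secondSymmetry_rigidity`). -/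
theorem secondSymmetry_exact_rigid {ν : ℝ} {w f : 𝕋³ → E³} {q : 𝕋³ → ℝ} {c M : ℝ}
    (hw : Torus.IsSmooth w) (hq : Torus.IsSmooth q) (hdiv : Torus.IsDivFree w)
    (hsteady : ∀ x, steadyMap ν w q c x = f x) (i : Fin 3)
    (hfi : ∀ x, Torus.partialDeriv i f x = 0) (hf3 : ∀ x, Torus.partialDeriv (2 : Fin 3) f x = 0)
    (hB : Bordered ν w c M) :
    ∃ t : ℝ, ∀ x, Torus.partialDeriv i w x = t • Torus.partialDeriv (2 : Fin 3) w x :=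
  Negative.bordered_secondSymmetry_rigidity hw hq hdiv hsteady i hfi hf3 hB

/-- Linear combinations of smooth divergence-free fields are divergence free (private copy of the helper in
`Negative/SecondSymmetry.lean`). [folklore] -/
theorem isDivFree_add_smul {f g : 𝕋³ → E³} (hf : Torus.IsSmooth f) (hg : Torus.IsSmooth g)
    (hfd : Torus.IsDivFree f) (hgd : Torus.IsDivFree g) (s : ℝ) : Torus.IsDivFree (f + s • g) := by
  intro x
  have hf0 := hfd x
  have hg0 := hgd x
  simp only [Torus.divergence] at hf0 hg0 ⊢
  have hcoord : ∀ j : Fin 3, (fun y => (f + s • g) y j) = (fun y => f y j) + s • (fun y => g y j) := by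
    intro j; funext y; simp [Pi.add_apply, Pi.smul_apply]
  have hterm : ∀ j : Fin 3, Torus.partialDeriv j (fun y => (f + s • g) y j) x
      = Torus.partialDeriv j (fun y => f y j) x + s * Torus.partialDeriv j (fun y => g y j) x := by
    intro j
    rw [hcoord j,
      Torus.partialDeriv_add ((hf.apply j).isContDiff (by simp)) (((hg.apply j).smul s).isContDiff (by simp)),
      Pi.add_apply, Torus.partialDeriv_const_smul ((hg.apply j).isContDiff (by simp)) s j, Pi.smul_apply,
      smul_eq_mul]
  simp only [hterm, Finset.sum_add_distrib, ← Finset.mul_sum, hf0, hg0, mul_zero, add_zero]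

/-- Linear combinations of smooth mean-zero fields have zero mean. [folklore] -/
theorem hasZeroMean_add_smul {f g : 𝕋³ → E³} (hf : Torus.IsSmooth f) (hg : Torus.IsSmooth g)
    (hfm : Torus.HasZeroMean f) (hgm : Torus.HasZeroMean g) (s : ℝ) : Torus.HasZeroMean (f + s • g) := by
  unfold Torus.HasZeroMean at hfm hgm ⊢
  have h1 : (fun x => (f + s • g) x) = fun x => f x + s • g x := by funext x; simp
  have h2 : Integrable (fun x => s • g x) volume := hg.integrable.smul s
  rw [h1, integral_add hf.integrable h2, integral_smul, hfm, hgm, smul_zero, add_zero]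

/-- **(D4) Border-corrected translation modes bound the bordered constant from below** (general form; the
landed `Negative.bordered_translationMode_le` of `Negative/HorizontalModes.lean`, p159826, re-proved here against
`Bordered`/`steadyMap`). At ANY smooth divergence-free base carrying the bordered clause with constant `M`, for
every direction `i` there is `t` (`= ⟨∂ᵢw,∂₃w⟩/‖∂₃w‖₂²`) with `∫‖∂ᵢw − t∂₃w‖² ≤ M² ∫‖∂ᵢS − t∂₃S‖²`,
`S` the steady map — no steadiness, no symmetry assumed. Reading: with `S = f + R`, an `x₃`-invariant force and
an `Ḣ¹`-accurate state, `M ≥ ‖∂ᵢw − t∂₃w‖₂/(‖∂ᵢf‖₂ + o(1))`; on the intended monophase family the numerator is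
`≍ ν^{-1/2}` (oblique wavevector of variable direction on the band), so `K₀ = 0` is impossible THERE; not
refutable in general (an `O(1)` slack in `L²`-gradient is enough for `(w·∇)w` to stay loud). -/
theorem horizontalMode_le {ν : ℝ} {w : 𝕋³ → E³} {q : 𝕋³ → ℝ} {c M : ℝ}
    (hw : Torus.IsSmooth w) (hq : Torus.IsSmooth q) (hdiv : Torus.IsDivFree w) (i : Fin 3)
    (hB : Bordered ν w c M) :
    ∃ t : ℝ, MeasureTheory.integral MeasureTheory.volume
        (fun x => ‖Torus.partialDeriv i w x - t • Torus.partialDeriv (2 : Fin 3) w x‖ ^ 2) ≤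
      M ^ 2 * MeasureTheory.integral MeasureTheory.volume (fun x =>
        ‖Torus.partialDeriv i (steadyMap ν w q c) x - t • Torus.partialDeriv (2 : Fin 3) (steadyMap ν w q c) x‖ ^ 2) := by
  set w3 := Torus.partialDeriv (2 : Fin 3) w with hw3def
  set wi := Torus.partialDeriv i w with hwidef
  have hw3 : Torus.IsSmooth w3 := hw.partialDeriv 2
  have hwi : Torus.IsSmooth wi := hw.partialDeriv i
  set D := MeasureTheory.integral MeasureTheory.volume (fun x => ‖w3 x‖ ^ 2) with hDdef
  have hD1 : 1 ≤ M ^ 2 * D := one_le_of_bordered hB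
  have hDpos : 0 < D := by
    by_contra hle
    have hle' : D ≤ 0 := le_of_not_gt hle
    have : M ^ 2 * D ≤ 0 := mul_nonpos_of_nonneg_of_nonpos (sq_nonneg M) hle'
    linarith
  set P := MeasureTheory.integral MeasureTheory.volume (fun x => inner ℝ (wi x) (w3 x)) with hPdef
  set s : ℝ := -(P / D) with hsdef
  have hv : Torus.IsSmooth (wi + s • w3) := hwi.add (hw3.smul s)
  have hr : Torus.IsSmooth (Torus.partialDeriv i q + s • Torus.partialDeriv (2 : Fin 3) q) :=
    (hq.partialDeriv i).add ((hq.partialDeriv 2).smul s)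
  have hvd : Torus.IsDivFree (wi + s • w3) :=
    isDivFree_add_smul hwi hw3 (Negative.isDivFree_partialDeriv hw hdiv i)
      (Negative.isDivFree_partialDeriv hw hdiv 2) s
  have hvm : Torus.HasZeroMean (wi + s • w3) :=
    hasZeroMean_add_smul hwi hw3 (Torus.hasZeroMean_partialDeriv hw i) (Torus.hasZeroMean_partialDeriv hw 2) s
  have key := hB (wi + s • w3) (Torus.partialDeriv i q + s • Torus.partialDeriv (2 : Fin 3) q) 0 hv hr hvd hvm
  have hL : ∀ x, Torus.convect w (wi + s • w3) x + Torus.convect (wi + s • w3) w x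
      - ν • Torus.laplacian (wi + s • w3) x
      + Torus.gradient (Torus.partialDeriv i q + s • Torus.partialDeriv (2 : Fin 3) q) x
      - c • Torus.partialDeriv (2 : Fin 3) (wi + s • w3) x
      - (0 : ℝ) • Torus.partialDeriv (2 : Fin 3) w x
      = Torus.partialDeriv i (steadyMap ν w q c) x + s • Torus.partialDeriv (2 : Fin 3) (steadyMap ν w q c) x := by
    intro x
    rw [zero_smul, sub_zero,
      Negative.linearisation_add_smul (w := w) (ν := ν) (c := c) hwi hw3 (hq.partialDeriv i) (hq.partialDeriv 2) s x,
      hwidef, hw3def, Negative.linearisation_partialDeriv_eq hw hq ν c i x,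
      Negative.linearisation_partialDeriv_eq hw hq ν c 2 x]
    rfl
  have hint_i : Integrable (fun x => inner ℝ (wi x) (w3 x)) volume := (hwi.inner hw3).integrable
  have hint_3 : Integrable (fun x => inner ℝ (w3 x) (w3 x)) volume := (hw3.inner hw3).integrable
  have hD' : MeasureTheory.integral MeasureTheory.volume (fun x => inner ℝ (w3 x) (w3 x)) = D := by
    rw [hDdef]
    refine integral_congr_ae (ae_of_all _ fun x => ?_)
    simp only [real_inner_self_eq_norm_sq]
  have hborder : MeasureTheory.integral MeasureTheory.volume
      (fun x => inner ℝ ((wi + s • w3) x) (Torus.partialDeriv (2 : Fin 3) w x)) = 0 := by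
    have h1 : (fun x => inner ℝ ((wi + s • w3) x) (Torus.partialDeriv (2 : Fin 3) w x))
        = fun x => inner ℝ (wi x) (w3 x) + s * inner ℝ (w3 x) (w3 x) := by
      funext x
      simp only [Pi.add_apply, Pi.smul_apply, inner_add_left, inner_smul_left, RCLike.conj_to_real, ← hw3def]
    rw [h1, integral_add hint_i (hint_3.const_mul s), integral_const_mul, hD', ← hPdef, hsdef]
    field_simp
    ring
  refine ⟨P / D, ?_⟩
  have hvx : ∀ x, (wi + s • w3) x = Torus.partialDeriv i w x - (P / D) • Torus.partialDeriv (2 : Fin 3) w x := by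
    intro x
    simp only [Pi.add_apply, Pi.neg_apply, Pi.smul_apply, hsdef, neg_smul, ← hwidef, ← hw3def,
      sub_eq_add_neg]
  have hLx : ∀ x, Torus.partialDeriv i (steadyMap ν w q c) x + s • Torus.partialDeriv (2 : Fin 3) (steadyMap ν w q c) x
      = Torus.partialDeriv i (steadyMap ν w q c) x - (P / D) • Torus.partialDeriv (2 : Fin 3) (steadyMap ν w q c) x := by
    intro x
    simp only [hsdef, neg_smul, sub_eq_add_neg]
  have key' := key
  simp_rw [hL, hborder, hvx, hLx] at key'
  simpa using key'

/-- **(D3) Quasi-steady rigidity under a second symmetry (quantitative)** — (D4) read through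
`∂S = ∂R` in the two symmetric directions. Let `w, q, f` be smooth, `w` divergence free, `f` invariant under
`x₃`- AND `xᵢ`-translations, `R := S_{ν,c}(w,q) − f` the steady residual (no smallness assumed). If the
BORDERED clause holds at `(w,c)` with constant `M`, then for some `t` (`= ⟨∂ᵢw, ∂₃w⟩/‖∂₃w‖₂²`):
`∫‖∂ᵢw − t∂₃w‖² ≤ M² ∫‖∂ᵢR − t∂₃R‖²`. Along any family whose residual is small in `Ḣ¹` faster than `ν^{K₀}`
(the intended BKW family with a doubly-symmetric force: every `C^k` norm of `R_K` is `O(ν^{K/2})`) the states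
are asymptotically invariant along `eᵢ − t e₃`; `R ≡ 0` gives the landed rigidity
(`secondSymmetry_exact_rigid`). The crux itself bounds only `‖R‖₂`, so this constrains the construction,
it does not refute the crux. -/
theorem bordered_secondSymmetry_quasi {ν : ℝ} {w f : 𝕋³ → E³} {q : 𝕋³ → ℝ} {c M : ℝ}
    (hw : Torus.IsSmooth w) (hq : Torus.IsSmooth q) (hf : Torus.IsSmooth f) (hdiv : Torus.IsDivFree w)
    (i : Fin 3) (hfi : ∀ x, Torus.partialDeriv i f x = 0) (hf3 : ∀ x, Torus.partialDeriv (2 : Fin 3) f x = 0)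
    (hB : Bordered ν w c M) :
    ∃ t : ℝ, MeasureTheory.integral MeasureTheory.volume
        (fun x => ‖Torus.partialDeriv i w x - t • Torus.partialDeriv (2 : Fin 3) w x‖ ^ 2) ≤
      M ^ 2 * MeasureTheory.integral MeasureTheory.volume (fun x =>
        ‖Torus.partialDeriv i (fun y => steadyMap ν w q c y - f y) x
          - t • Torus.partialDeriv (2 : Fin 3) (fun y => steadyMap ν w q c y - f y) x‖ ^ 2) := by
  obtain ⟨t, ht⟩ := horizontalMode_le (q := q) hw hq hdiv i hB
  have hS : Torus.IsSmooth (steadyMap ν w q c) :=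
    (((hw.convect hw).sub (hw.laplacian.smul ν)).add hq.gradient).sub ((hw.partialDeriv 2).smul c)
  have hRs : Torus.IsSmooth (fun y => steadyMap ν w q c y - f y) := hS.sub hf
  have hSR : steadyMap ν w q c = (fun y => steadyMap ν w q c y - f y) + f := by funext y; simp
  have hdS : ∀ (j : Fin 3), (∀ x, Torus.partialDeriv j f x = 0) →
      ∀ x, Torus.partialDeriv j (steadyMap ν w q c) x
        = Torus.partialDeriv j (fun y => steadyMap ν w q c y - f y) x := by
    intro j hj x
    nth_rw 1 [hSR]
    rw [Torus.partialDeriv_add (hRs.isContDiff (by simp)) (hf.isContDiff (by simp)), Pi.add_apply, hj x,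
      add_zero]
  refine ⟨t, ?_⟩
  have hfun : (fun x => ‖Torus.partialDeriv i (steadyMap ν w q c) x
        - t • Torus.partialDeriv (2 : Fin 3) (steadyMap ν w q c) x‖ ^ 2)
      = fun x => ‖Torus.partialDeriv i (fun y => steadyMap ν w q c y - f y) x
        - t • Torus.partialDeriv (2 : Fin 3) (fun y => steadyMap ν w q c y - f y) x‖ ^ 2 := by
    funext x
    rw [hdS i hfi x, hdS 2 hf3 x]
  rw [hfun] at ht
  exact ht

/-- **(D4, crux level).** Along the subsequence of ANY witness family of the route target (= the crux's
consequent), both horizontal border-corrected translation modes are controlled by the polynomial constant times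
the corresponding derivatives of the steady map `S = f + R`:
`∫‖∂ᵢw − t∂₃w‖² ≤ (C₀ν_n^{-K₀})² ∫‖∂ᵢS − t∂₃S‖²` for every `i` (some `t = t(i,n)`). -/
theorem target_witness_horizontalModes (hT : NonresonantTaylorWaves) :
    ∃ (ν : ℕ → ℝ) (C₀ : ℝ) (K₀ : ℕ), ∀ K : ℕ, ∀ N : ℕ, ∃ n : ℕ, N ≤ n ∧ ∃ (w : 𝕋³ → E³) (q : 𝕋³ → ℝ) (c : ℝ),
      ∀ i : Fin 3, ∃ t : ℝ, MeasureTheory.integral MeasureTheory.volume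
          (fun x => ‖Torus.partialDeriv i w x - t • Torus.partialDeriv (2 : Fin 3) w x‖ ^ 2) ≤
        (C₀ * (ν n)⁻¹ ^ K₀) ^ 2 * MeasureTheory.integral MeasureTheory.volume (fun x =>
          ‖Torus.partialDeriv i (steadyMap (ν n) w q c) x
            - t • Torus.partialDeriv (2 : Fin 3) (steadyMap (ν n) w q c) x‖ ^ 2) := by
  obtain ⟨f, -, -, -, ν, E, ε₀, C₀, K₀, -, -, -, hK⟩ := hT
  refine ⟨ν, C₀, K₀, fun K N => ?_⟩
  obtain ⟨C, hC⟩ := hK K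
  obtain ⟨n, hn, w, q, c, hw, hq, hwd, -, -, -, -, -, -, -, -, hB⟩ := hC N
  exact ⟨n, hn, w, q, c, fun i => horizontalMode_le hw hq hwd i hB⟩

/-! ## Targets — line `birth` (PICKED 2026-08-17T11:38Z; skeleton as of 12:18Z: stubs `stub_spineCore` (1′),
`stub_kellerAnalysis` (1b), `stub_kellerAlgebra` (1c) open; `stub_linearisedEnergyIneq` (2a, p158645),
`stub_residualPerturbation` (2b, p159030), `stub_transferAlgebra` (2c, p158885) LANDED by the lead)

No stub is broken. Verdicts (cdisprove cycle 1):

* `stub_kellerAlgebra` (1c, real arithmetic `⊢ V² + b² ≤ (10Λ³)²(Fn² + Bd²)`): TRUE on paper with margin —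
  `|b| ≤ (Fn + ρ′V)/Pr ≤ Λ(Fn + ρ′V)`, `V ≤ ΛFn + Λ²|b| + (1+Λ)|Bd|` (using `Φ ≤ Λ`, `Φ⁻¹ ≤ Λ`, `ρΛ/Φ² ≤ ρΛ³ ≤ 1`),
  absorb with `ρ′Λ³ ≤ ½`: `|b| ≤ 3ΛFn + 2|Bd|`, `V ≤ 4Λ³(Fn + |Bd|)`, so `V² + b² ≤ 50Λ⁶(Fn² + Bd²)`; numerically
  robust: saturating `V, U, |b|` at the fixed point over 3·10⁵ random `(Λ ∈ [1,10³], ρ, ρ′, Φ, Pr, Fn, Bd)` gives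
  `sup (V²+b²)/((10Λ³)²(Fn²+Bd²)) ≈ 0.23 < 1` (seat folder `scratch/keller_search.py`); degenerate case
  `Fn = Bd = 0` forces `b = V = 0` (`Pr ≥ Λ⁻¹ > ρ′Λ²`). No counterexample.
* `stub_kellerAnalysis` (1b): TRUE — (i) Minkowski for `v = u + s∂₃w`; (ii) `u = v − s∂₃w` is an admissible
  test field (`isDivFree_partialDeriv`, `Torus.hasZeroMean_partialDeriv`, and the landed private-style helpers
  `isDivFree_add_smul` / `hasZeroMean_add_smul` of this file / `Negative/SecondSymmetry`) with `⟨u, ∂₃w⟩ = 0` by the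
  choice of `s`, and `A(u, r − s q₃) = A(v, r) − sA(∂₃w, q₃) = F + b∂₃w − sA(∂₃w, q₃)` is EXACTLY the landed
  linearity `Negative.linearisation_add_smul` (with `s ↦ −s`); (iii) pair `F = A(v,r) − b∂₃w` with `ψ`,
  Cauchy–Schwarz and `‖ψ‖₂ ≤ 1`. Hint for the prover: the border-killing test field is the one used in
  `Negative.bordered_translationMode_le` (same bookkeeping, `field_simp`).
* `stub_transferAlgebra` (2c, landed): had been stress-tested here before it landed — `sup ≈ 0.39 < 1` over 2.3·10⁵
  extremal samples (`scratch/transfer_search.py`, `transfer_climb.py`); consistent.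
* `stub_spineCore` (1′): it IS the crux for ONE reference family, now as KELLER DATA (reduced gap on `u ⊥ ∂₃w₁`,
  approximate kernel `∂₃w₁`, approximate cokernel `ψ`, pairing `Λ|⟨ψ,∂₃w₁⟩| ≥ 1`). Everything in §A–§D applies to
  the spine: genuinely 3-D (§B; here even `Λ⁻¹ ≤ ‖∂₃w₁‖₂` is asserted); for an `x₃`-invariant force the approximate
  kernel clause `‖A₁(∂₃w₁,q₃)‖₂ ≤ Λ⁻³` is the translation identity applied to an `Ḣ¹`-accurate spine
  (`Negative.linearisation_partialDeriv_eq`: `A₁(∂₃w₁, ∂₃q₁) = ∂₃R₁`), so it costs nothing; the reduced gap +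
  cokernel pairing is the open content (adjoint cell mode; DSZ bracket on non-isotach streamlines,
  BarrierNoteDSZBracket.md). Finite-dimensional sanity of the data set: consistent (one small singular value with
  right vector `∂₃w₁`, left vector `ψ`, `⟨ψ,∂₃w₁⟩ ≠ 0`). No cheap kill: existential over spines. Note the cokernel
  clause quantifies over ALL smooth `r`, which silently forces `ψ` to be (weakly) divergence free — intended.
-/

end Summit.AnomalousDissipation.AnomalousDissipation.Cruxes.NonresonantSelection.Disproof

end
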